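import Summits.HubbardSuperconductivity.HubbardSuperconductivity.Theses.AposterioriCapRg
import Summits.HubbardSuperconductivity.HubbardSuperconductivity.Theses.KacWindowPenalty
import Summits.HubbardSuperconductivity.HubbardSuperconductivity.Theorems.WcbcsSsbToTorusLRO.Negative.WindowInfraredBound1089
import Summits.HubbardSuperconductivity.HubbardSuperconductivity.Theorems.WcbcsSsbToTorusLRO.Negative.FacePurityDissection
import Summits.HubbardSuperconductivity.HubbardSuperconductivity.Theorems.AposterioriCapRgSsbToEvenTorusLroDoubleCommBound
import Summits.HubbardSuperconductivity.HubbardSuperconductivity.Theorems.WeakCouplingBCSWcbcsSsbToTorusLROMomentClosure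
import Summits.HubbardSuperconductivity.HubbardSuperconductivity.Theorems.AposterioriCapRgSsbToEvenTorusLroWindowLatticeSum
import Literature.MathematicalPhysics.QuantumLattice.PairFieldMomentum
import Literature.MathematicalPhysics.QuantumLattice.TorusPairSusceptibility
import Literature.MathematicalPhysics.QuantumLattice.DWaveSourceProofs
import HarnessLib

/-!
# Crux `SsbToEvenTorusLro` (stmt-HubbardSuperconductivity-1315), line `pair-yrast-landau-floor` — the PROVED
# composition: pair-yrast floor ⇒ infrared leak, and the crux from {face purity | repelled order} + pair-yrast floor

Route `AposterioriCapRg`, crux rank 5: `∀ U δ μ, 0 < U → δ ∈ (0,1) → DensityMatched U δ μ → HasDWaveOrder U μ →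
HasDWavePairFieldLROAt U δ` (Koma–Tasaki `d`-wave order + density matching ⇒ `d`-wave pair-field LRO of EVERY
normalised `(N_L, S^z = 0)`-sector ground state on even tori). This file lands the sorry-free part of the lead's line
skeleton (`Cruxes/SsbToEvenTorusLro/Lines/pair_yrast_landau_floor.lean`), so that the line's two remaining registered
OPEN stubs — `stub_pairYrastFloor` (Y: a Landau floor `c|q|^α`, `α < 2`, for the pair modes `Δ_d(q)ψ`, `Δ_d(q)ᴴψ` of
every sector ground state at small `q ≠ 0`) and `stub_facePurity` (FP: every-ground-state block pair coherence at
every fixed scale) or its alternative door `stub_repelledOrderPersistence` (ROP) — are glued to the crux BY NAME by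
tree theorems a planner can cite:

* §1 REVERSED FEYNMAN–BIJL, two-sided (`reversed_feynman_bijl`): for `Kψ = Eψ`, `K` Hermitian, ANY `A`, floors `g₁, g₂`
  at `Aψ`, `Aᴴψ` give `g₁‖Aψ‖² + g₂‖Aᴴψ‖² ≤ Re⟨ψ,(Aᴴ[K,A] − [K,A]Aᴴ)ψ⟩` — a LOWER bound on the energies of the two pair
  modes is an UPPER bound on their weights (Feynman 1954 / Pitaevskii–Stringari 1991 read backwards). The identity
  behind it is REUSED from the tree (`WcbcsSsbToTorusLRO.mc_dotProduct_doubleComm_of_eigen`, adapted by a sibling seat from this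
  line's published skeleton; the one-sided corollary also exists as `wib_weight_le_of_floors`).
* §2 `pairStructureFactor_le_of_floor`: with the LANDED extensivity bound (B) `stub_doubleCommBound` (p84835),
  `S_ψ(m) ≤ C(1+|μ'|)/(c|q_m|^α)` for every sector ground state obeying the Landau floor at `m`.
* §3 `infraredCeilingAt_of_pairYrastFloorAt` ((Y) ⇒ ceiling `S_ψ(m) ≤ A|q_m|^{-α}`, the minimal infrared input),
  `infraredLeak_of_infraredCeilingAt` (ceiling + LANDED lattice sum `stub_windowLatticeSum` (p85984) ⇒ leak) and their
  composition `infraredLeak_of_pairYrastFloorAt`: the pointwise infrared LEAK at `(U,δ)` — the `hIR` of the landed Fejér-closure dissection `floor_of_deriv_of_leak`, and the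
  pointwise content of item stmt-1089 `KacWindowPenalty.WindowInfraredBound` (so (Y) is also a SUPPLIER for that item).
* §4 POINTWISE MATRIX: `hasDWavePairFieldLROAt_of_facePurityAt_of_pairYrastFloorAt` (FP(U,δ) ∧ Y(U,δ) ⇒ matrix) and
  `hasDWavePairFieldLROAt_of_facePurityAt_of_infraredCeilingAt` (FP ∧ ceiling ⇒ matrix). (The ROP door — DM ∧
  ROP-floor(U,μ) ∧ Y(U,δ) ⇒ matrix through the landed reduction `facePurity_of_repelledOrderAt`, p90057 — is the
  companion file `…GlueRepelledOrder.lean`.)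
* §5 CRUX GLUE BY NAME: `SsbToEvenTorusLro_of_facePurity_of_pairYrastFloor`,
  `SsbToEvenTorusLro_of_facePurity_of_infraredCeiling` (minimal residue), and the dissection `ssbToEvenTorusLro_iff_facePurity_of_pairYrastFloor`:
  MODULO (Y), the crux IS derivative face purity (necessity by the sibling's landed `deriv_of_hasDWavePairFieldLROAt`).
* §6 WHAT THE ROUTE CONSUMES: with item stmt-1089 `KacWindowPenalty.WindowInfraredBound` BY NAME (half range `δ < 1/2`),
  (FP) alone gives the transfer where the route uses it, and `hubbardSuperconductivity_of_facePurity_of_windowInfraredBound_of_fixedPoint`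
  re-runs the route's `closes` through the box: for THIS route the crux reduces to {FP or ROP, item 1089}, exactly the
  residue of the sibling cruxes stmt-2009 / stmt-10439; (Y) is then a candidate SUPPLIER line for 1089 (§3).

Sources: T. Koma, H. Tasaki, J. Stat. Phys. 76 (1994) 745, Thm 2.2 (double-commutator method); H. Tasaki,
H. Watanabe, PRB 104 (2021) L180501, eq. (10) (the `q = 0` case); L. Pitaevskii, S. Stringari, J. Low Temp. Phys. 85
(1991) 377 (T = 0 moment inequalities); R. P. Feynman, Phys. Rev. 94 (1954) 262. All statements below are folklore
finite-dimensional linear algebra / bookkeeping on the literal route terms; no definition is introduced.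
-/

noncomputable section

namespace Summit.HubbardSuperconductivity.HubbardSuperconductivity.Theorems

-- summit = problem name (single-conjunct summit), D-0017
set_option linter.dupNamespace false

open Literature.MathematicalPhysics.QuantumLattice Literature.Probability.LatticeModels
open Literature.Barriers.HubbardSuperconductivity (HasDWavePairFieldLROAt)
open Filter Set Matrix
open scoped ComplexOrder ComplexConjugate
open Summit.HubbardSuperconductivity.HubbardSuperconductivity.Theses.AposterioriCapRg (SsbToEvenTorusLro FixedPointDWaveOrder)
open Summit.HubbardSuperconductivity.HubbardSuperconductivity.Theses.KacWindowPenalty (WindowInfraredBound)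
open Summit.HubbardSuperconductivity.WcbcsSsbToTorusLRO.Negative
  (floor_of_deriv_of_leak hasDWavePairFieldLROAt_of_floor leak_of_windowInfraredBound)

/-! ## §1 Reversed Feynman–Bijl (abstract) -/

section Abstract

variable {n : Type*} [Fintype n]

/-- **Reversed Feynman–Bijl, two-sided.** For a Hermitian `K`, an eigenvector `Kψ = Eψ` and any `A`:
quadratic-form floors `Re⟨Aψ, K Aψ⟩ ≥ (E + g₁)‖Aψ‖²`, `Re⟨Aᴴψ, K Aᴴψ⟩ ≥ (E + g₂)‖Aᴴψ‖²` give
`g₁‖Aψ‖² + g₂‖Aᴴψ‖² ≤ Re⟨ψ, (Aᴴ[K,A] - [K,A]Aᴴ) ψ⟩` — a LOWER bound on the energies of the modes `Aψ`, `Aᴴψ` is an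
UPPER bound on their weights (Feynman 1954 read backwards; Pitaevskii–Stringari 1991; Tasaki–Watanabe 2021 at `q = 0`).
From the landed own-bottom identity `WcbcsSsbToTorusLRO.mc_dotProduct_doubleComm_of_eigen` (itself adapted from this
line's published skeleton). [folklore] -/
theorem reversed_feynman_bijl {K : Matrix n n ℂ} (hK : K.IsHermitian) {ψ : n → ℂ} {E g₁ g₂ : ℝ}
    (hψ : K *ᵥ ψ = (E : ℂ) • ψ) (A : Matrix n n ℂ)
    (h₁ : (E + g₁) * (star (A *ᵥ ψ) ⬝ᵥ (A *ᵥ ψ)).re ≤ (star (A *ᵥ ψ) ⬝ᵥ (K *ᵥ (A *ᵥ ψ))).re)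
    (h₂ : (E + g₂) * (star (Aᴴ *ᵥ ψ) ⬝ᵥ (Aᴴ *ᵥ ψ)).re ≤
      (star (Aᴴ *ᵥ ψ) ⬝ᵥ (K *ᵥ (Aᴴ *ᵥ ψ))).re) :
    g₁ * (star (A *ᵥ ψ) ⬝ᵥ (A *ᵥ ψ)).re + g₂ * (star (Aᴴ *ᵥ ψ) ⬝ᵥ (Aᴴ *ᵥ ψ)).re ≤
      (star ψ ⬝ᵥ ((Aᴴ * (K * A - A * K) - (K * A - A * K) * Aᴴ) *ᵥ ψ)).re := by
  rw [WcbcsSsbToTorusLRO.mc_dotProduct_doubleComm_of_eigen hK hψ A]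
  simp only [Complex.add_re, Complex.sub_re, Complex.re_ofReal_mul]
  nlinarith [h₁, h₂]

end Abstract

/-! ## §2 The per-momentum ceiling (with the landed extensivity bound) -/

/-- **Per-momentum ceiling** (the reversed Feynman–Bijl step on the torus): for a normalised sector ground state
`ψ`, a momentum label `m` with `|q_m| > 0`, a double-commutator ceiling `C(1+|μ'|)L²` and the two Landau floors
`c|q_m|^α` w.r.t. `K = H - μ'N̂` at `Δ_d(m)ψ`, `Δ_d(m)ᴴψ`, the pair structure factor obeys
`S_ψ(m) ≤ C(1+|μ'|) / (c |q_m|^α)`. [folklore] -/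
theorem pairStructureFactor_le_of_floor {U : ℝ} {L : ℕ} [NeZero L] {N : ℕ} {ψ : Fock (Orb (FermionTorus 2 L))}
    (hψ : IsGroundStateInSector (hubbardTorus 2 L 1 U) N 0 ψ) (hψ1 : star ψ ⬝ᵥ ψ = 1)
    {m : TorusSite 2 L} {c α μ' C : ℝ} (hc : 0 < c) (hm : 0 < momentumNormSq L m)
    (hB : |(star ψ ⬝ᵥ (((pairFieldAt dWaveFormFactor L m)ᴴ * (hubbardTorusWith 2 L 1 U μ' * pairFieldAt dWaveFormFactor L m - pairFieldAt dWaveFormFactor L m * hubbardTorusWith 2 L 1 U μ') - (hubbardTorusWith 2 L 1 U μ' * pairFieldAt dWaveFormFactor L m - pairFieldAt dWaveFormFactor L m * hubbardTorusWith 2 L 1 U μ') * (pairFieldAt dWaveFormFactor L m)ᴴ) *ᵥ ψ)).re| ≤ C * (1 + |μ'|) * (L : ℝ) ^ 2 * (star ψ ⬝ᵥ ψ).re)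
    (hY : ∀ E : ℝ, hubbardTorusWith 2 L 1 U μ' *ᵥ ψ = (E : ℂ) • ψ → (E + c * momentumNormSq L m ^ (α / 2)) * (star (pairFieldAt dWaveFormFactor L m *ᵥ ψ) ⬝ᵥ (pairFieldAt dWaveFormFactor L m *ᵥ ψ)).re ≤ (star (pairFieldAt dWaveFormFactor L m *ᵥ ψ) ⬝ᵥ (hubbardTorusWith 2 L 1 U μ' *ᵥ (pairFieldAt dWaveFormFactor L m *ᵥ ψ))).re ∧ (E + c * momentumNormSq L m ^ (α / 2)) * (star ((pairFieldAt dWaveFormFactor L m)ᴴ *ᵥ ψ) ⬝ᵥ ((pairFieldAt dWaveFormFactor L m)ᴴ *ᵥ ψ)).re ≤ (star ((pairFieldAt dWaveFormFactor L m)ᴴ *ᵥ ψ) ⬝ᵥ (hubbardTorusWith 2 L 1 U μ' *ᵥ ((pairFieldAt dWaveFormFactor L m)ᴴ *ᵥ ψ))).re) :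
    pairStructureFactor dWaveFormFactor L ψ m ≤ C * (1 + |μ'|) / c * (momentumNormSq L m ^ (α / 2))⁻¹ := by
  -- `ψ` is a `K`-eigenvector with `E = E₀(N) - μ'N`
  have hK : (hubbardTorusWith 2 L 1 U μ').IsHermitian := isHermitian_hubbardTorusWith L 1 U μ'
  have hE := sub_smul_totalNumber_mulVec_of_isGroundStateInSector hψ μ'
  rw [← hubbardTorusWith_eq] at hE
  obtain ⟨h₁, h₂⟩ := hY _ hE
  have hg : 0 < c * momentumNormSq L m ^ (α / 2) := mul_pos hc (Real.rpow_pos_of_pos hm _)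
  have hD : (star ψ ⬝ᵥ (((pairFieldAt dWaveFormFactor L m)ᴴ * (hubbardTorusWith 2 L 1 U μ' * pairFieldAt dWaveFormFactor L m - pairFieldAt dWaveFormFactor L m * hubbardTorusWith 2 L 1 U μ') - (hubbardTorusWith 2 L 1 U μ' * pairFieldAt dWaveFormFactor L m - pairFieldAt dWaveFormFactor L m * hubbardTorusWith 2 L 1 U μ') * (pairFieldAt dWaveFormFactor L m)ᴴ) *ᵥ ψ)).re ≤ C * (1 + |μ'|) * (L : ℝ) ^ 2 := by
    have := (le_abs_self _).trans hB
    rwa [hψ1, Complex.one_re, mul_one] at this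
  -- reversed Feynman–Bijl with `g₁ = g₂ = g`, dropping the nonnegative weight of `Δᴴψ`
  have hfb := reversed_feynman_bijl hK hE (pairFieldAt dWaveFormFactor L m) h₁ h₂
  have h0 : 0 ≤ (star ((pairFieldAt dWaveFormFactor L m)ᴴ *ᵥ ψ) ⬝ᵥ ((pairFieldAt dWaveFormFactor L m)ᴴ *ᵥ ψ)).re :=
    (Complex.nonneg_iff.1 (dotProduct_star_self_nonneg _)).1
  have hw : (star (pairFieldAt dWaveFormFactor L m *ᵥ ψ) ⬝ᵥ (pairFieldAt dWaveFormFactor L m *ᵥ ψ)).re ≤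
      C * (1 + |μ'|) * (L : ℝ) ^ 2 / (c * momentumNormSq L m ^ (α / 2)) := by
    rw [le_div_iff₀ hg]
    nlinarith [mul_nonneg hg.le h0]
  have hL : (0 : ℝ) < (L : ℝ) ^ 2 := by
    have : (0 : ℝ) < L := Nat.cast_pos.2 (Nat.pos_of_ne_zero (NeZero.ne L))
    positivity
  rw [pairStructureFactor_apply, div_le_iff₀ hL]
  refine hw.trans (le_of_eq ?_)
  field_simp

/-! ## §3 Pair-yrast floor ⇒ infrared leak (with the landed lattice sum) -/

/-- **Pair-yrast floor ⇒ infrared CEILING** at `(U, δ)` for `U > 0` (with the LANDED extensivity bound (B)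
`stub_doubleCommBound`, p84835): the Landau floor for the pair modes of every sector ground state gives the
Goldstone-shape ceiling `S_ψ(m) ≤ A·|q_m|^{-α}` on the punctured window, `A = C(1+|M₀|)/c` — the MINIMAL form of the
line's infrared input actually consumed downstream (`infraredLeak_of_infraredCeilingAt`). [folklore] -/
theorem infraredCeilingAt_of_pairYrastFloorAt {U δ : ℝ} (hU : 0 < U)
    (hYat : ∃ c α η M₀ : ℝ, 0 < c ∧ α < 2 ∧ 0 < η ∧ ∀ᶠ k : ℕ in Filter.atTop, ∀ ψ : Fock (Orb (FermionTorus 2 (2 * k + 1 + 1))), IsGroundStateInSector (hubbardTorus 2 (2 * k + 1 + 1) 1 U) (2 * ⌊(1 - δ) * ((2 * k + 1 + 1 : ℕ) : ℝ) ^ 2 / 2⌋₊) 0 ψ → star ψ ⬝ᵥ ψ = 1 → ∀ m : TorusSite 2 (2 * k + 1 + 1), m ≠ 0 → momentumNormSq (2 * k + 1 + 1) m ≤ η ^ 2 → ∃ μ' : ℝ, |μ'| ≤ M₀ ∧ ∀ E : ℝ, hubbardTorusWith 2 (2 * k + 1 + 1) 1 U μ' *ᵥ ψ = (E : ℂ)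 • ψ → (E + c * momentumNormSq (2 * k + 1 + 1) m ^ (α / 2)) * (star (pairFieldAt dWaveFormFactor (2 * k + 1 + 1) m *ᵥ ψ) ⬝ᵥ (pairFieldAt dWaveFormFactor (2 * k + 1 + 1) m *ᵥ ψ)).re ≤ (star (pairFieldAt dWaveFormFactor (2 * k + 1 + 1) m *ᵥ ψ) ⬝ᵥ (hubbardTorusWith 2 (2 * k + 1 + 1) 1 U μ' *ᵥ (pairFieldAt dWaveFormFactor (2 * k + 1 + 1) m *ᵥ ψ))).re ∧ (E + c * momentumNormSq (2 * k + 1 + 1) m ^ (α / 2)) * (star ((pairFieldAt dWaveFormFactor (2 * k + 1 + 1) m)ᴴ *ᵥ ψ) ⬝ᵥ ((pairFieldAt dWaveFormFactor (2 * k + 1 + 1) m)ᴴ *ᵥ ψ)).re ≤ (star ((pairFieldAt dWaveFormFactor (2 * k + 1 + 1) m)ᴴ *ᵥ ψ) ⬝ᵥ (hubbardTorusWith 2 (2 * k + 1 + 1) 1 U μ' *ᵥ ((pairFieldAt dWaveFormFactor (2 * k + 1 + 1) m)ᴴ *ᵥ ψ))).re) :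
    ∃ A α η : ℝ, α < 2 ∧ 0 < η ∧ ∀ᶠ k : ℕ in Filter.atTop, ∀ ψ : Fock (Orb (FermionTorus 2 (2 * k + 1 + 1))), IsGroundStateInSector (hubbardTorus 2 (2 * k + 1 + 1) 1 U) (2 * ⌊(1 - δ) * ((2 * k + 1 + 1 : ℕ) : ℝ) ^ 2 / 2⌋₊) 0 ψ → star ψ ⬝ᵥ ψ = 1 → ∀ m : TorusSite 2 (2 * k + 1 + 1), m ≠ 0 → momentumNormSq (2 * k + 1 + 1) m ≤ η ^ 2 → pairStructureFactor dWaveFormFactor (2 * k + 1 + 1) ψ m ≤ A * (momentumNormSq (2 * k + 1 + 1) m ^ (α / 2))⁻¹ := by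
  obtain ⟨c, α, η, M₀, hc, hα, hη, hY⟩ := hYat
  obtain ⟨C, hC, hB⟩ := stub_doubleCommBound U hU
  refine ⟨C * (1 + |M₀|) / c, α, η, hα, hη, ?_⟩
  filter_upwards [hY] with k hYk
  intro ψ hψ hψ1 m hm0 hmη
  have hmpos : 0 < momentumNormSq (2 * k + 1 + 1) m :=
    lt_of_le_of_ne (momentumNormSq_nonneg m) (fun h => hm0 ((momentumNormSq_eq_zero_iff m).1 h.symm))
  obtain ⟨μ', hμ', hfl⟩ := hYk ψ hψ hψ1 m hm0 hmη
  have h1 := pairStructureFactor_le_of_floor hψ hψ1 hc hmpos (hB (2 * k + 1 + 1) μ' m ψ) hfl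
  refine h1.trans (mul_le_mul_of_nonneg_right ?_ (inv_nonneg.2 (Real.rpow_nonneg hmpos.le _)))
  refine div_le_div_of_nonneg_right ?_ hc.le
  exact mul_le_mul_of_nonneg_left (by linarith [hμ', le_abs_self M₀]) hC

/-- **Infrared ceiling ⇒ infrared ∀ b : ℝ, 0 < b → ∃ η : ℝ, 0 < η ∧ ∀ᶠ k : ℕ in Filter.atTop,
    ∀ ψ : Fock (Orb (FermionTorus 2 (2 * k + 1 + 1))),
      IsGroundStateInSector (hubbardTorus 2 (2 * k + 1 + 1) 1 U) (2 * ⌊(1 - δ) * (((2 * k + 1 + 1) : ℕ) : ℝ) ^ 2 / 2⌋₊) 0 ψ → star ψ ⬝ᵥ ψ = 1 →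
        (∑ m ∈ (Finset.univ.filter fun m : Literature.Probability.LatticeModels.TorusSite 2 (2 * k + 1 + 1) =>
            m ≠ 0 ∧ momentumNormSq (2 * k + 1 + 1) m < η ^ 2),
          pairStructureFactor dWaveFormFactor (2 * k + 1 + 1) ψ m) / ((2 * k + 1 + 1 : ℕ) : ℝ) ^ 2 ≤ b** at `(U, δ)` (with the LANDED lattice sum `stub_windowLatticeSum`, p85984):
a Goldstone-shape ceiling `S_ψ(m) ≤ A|q_m|^{-α}`, `α < 2`, on the punctured window of every sector ground state makes the
window weight `L⁻² Σ_{0<|q_m|<η} S_ψ(m)` as small as desired for small `η`, eventually along even sides — exactly the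
hypothesis `hIR` of the landed Fejér dissection `floor_of_deriv_of_leak`, i.e. the pointwise content of item stmt-1089
`KacWindowPenalty.WindowInfraredBound` at `(U, δ)`. (In `d = 2` the window sum converges iff `α < 2`: the exponent IS
the phase — linear phase mode of a superfluid `α = 1` vs the particle–hole continuum of a metal `α = 2`.) [folklore] -/
theorem infraredLeak_of_infraredCeilingAt {U δ : ℝ}
    (hC : ∃ A α η : ℝ, α < 2 ∧ 0 < η ∧ ∀ᶠ k : ℕ in Filter.atTop, ∀ ψ : Fock (Orb (FermionTorus 2 (2 * k + 1 + 1))), IsGroundStateInSector (hubbardTorus 2 (2 * k + 1 + 1) 1 U) (2 * ⌊(1 - δ) * ((2 * k + 1 + 1 : ℕ) : ℝ) ^ 2 / 2⌋₊) 0 ψ → star ψ ⬝ᵥ ψ = 1 → ∀ m : TorusSite 2 (2 * k + 1 + 1), m ≠ 0 → momentumNormSq (2 * k + 1 + 1) m ≤ η ^ 2 → pairStructureFactor dWaveFormFactor (2 * k + 1 + 1) ψ m ≤ A * (momentumNormSq (2 * k + 1 + 1) m ^ (α / 2))⁻¹) :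
    ∀ b : ℝ, 0 < b → ∃ η : ℝ, 0 < η ∧ ∀ᶠ k : ℕ in Filter.atTop,
    ∀ ψ : Fock (Orb (FermionTorus 2 (2 * k + 1 + 1))),
      IsGroundStateInSector (hubbardTorus 2 (2 * k + 1 + 1) 1 U) (2 * ⌊(1 - δ) * (((2 * k + 1 + 1) : ℕ) : ℝ) ^ 2 / 2⌋₊) 0 ψ → star ψ ⬝ᵥ ψ = 1 →
        (∑ m ∈ (Finset.univ.filter fun m : Literature.Probability.LatticeModels.TorusSite 2 (2 * k + 1 + 1) =>
            m ≠ 0 ∧ momentumNormSq (2 * k + 1 + 1) m < η ^ 2),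
          pairStructureFactor dWaveFormFactor (2 * k + 1 + 1) ψ m) / ((2 * k + 1 + 1 : ℕ) : ℝ) ^ 2 ≤ b := by
  intro b hb
  obtain ⟨A₀, α, η₀, hα, hη₀, hY⟩ := hC
  set A : ℝ := max A₀ 0 with hA_def
  have hA : 0 ≤ A := le_max_right _ _
  obtain ⟨η₁, hη₁, hlat⟩ := stub_windowLatticeSum α hα (b / (A + 1)) (by positivity)
  set η : ℝ := min η₀ η₁ with hη_def
  have hη : 0 < η := lt_min hη₀ hη₁
  obtain ⟨L₀, hL₀⟩ := hlat η hη (min_le_right _ _)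
  refine ⟨η, hη, ?_⟩
  filter_upwards [hY, Filter.eventually_ge_atTop L₀] with k hYk hk
  intro ψ hψ hψ1
  have hLk : L₀ ≤ 2 * k + 1 + 1 := by omega
  have hlat' := hL₀ (2 * k + 1 + 1) hLk
  -- termwise ceiling with the nonnegative constant `A`
  have hterm : ∀ m ∈ (Finset.univ.filter fun m : TorusSite 2 (2 * k + 1 + 1) =>
      m ≠ 0 ∧ momentumNormSq (2 * k + 1 + 1) m < η ^ 2),
      pairStructureFactor dWaveFormFactor (2 * k + 1 + 1) ψ m ≤ A * (momentumNormSq (2 * k + 1 + 1) m ^ (α / 2))⁻¹ := by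
    intro m hm
    rw [Finset.mem_filter] at hm
    obtain ⟨-, hm0, hmη⟩ := hm
    have hmη₀ : momentumNormSq (2 * k + 1 + 1) m ≤ η₀ ^ 2 :=
      hmη.le.trans (pow_le_pow_left₀ hη.le (min_le_left _ _) 2)
    have hinv : 0 ≤ (momentumNormSq (2 * k + 1 + 1) m ^ (α / 2))⁻¹ :=
      inv_nonneg.2 (Real.rpow_nonneg (momentumNormSq_nonneg m) _)
    exact (hYk ψ hψ hψ1 m hm0 hmη₀).trans (mul_le_mul_of_nonneg_right (le_max_left _ _) hinv)
  have hsum := Finset.sum_le_sum hterm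
  rw [← Finset.mul_sum] at hsum
  rw [div_le_iff₀ (by positivity)]
  calc (∑ m ∈ (Finset.univ.filter fun m : TorusSite 2 (2 * k + 1 + 1) =>
            m ≠ 0 ∧ momentumNormSq (2 * k + 1 + 1) m < η ^ 2),
          pairStructureFactor dWaveFormFactor (2 * k + 1 + 1) ψ m)
      ≤ A * ∑ m ∈ (Finset.univ.filter fun m : TorusSite 2 (2 * k + 1 + 1) =>
            m ≠ 0 ∧ momentumNormSq (2 * k + 1 + 1) m < η ^ 2),
          (momentumNormSq (2 * k + 1 + 1) m ^ (α / 2))⁻¹ := hsum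
    _ ≤ A * (b / (A + 1) * ((2 * k + 1 + 1 : ℕ) : ℝ) ^ 2) := mul_le_mul_of_nonneg_left hlat' hA
    _ ≤ b * ((2 * k + 1 + 1 : ℕ) : ℝ) ^ 2 := by
        rw [← mul_assoc]
        refine mul_le_mul_of_nonneg_right ?_ (by positivity)
        rw [mul_div_assoc', div_le_iff₀ (by positivity)]
        nlinarith

/-- **Pair-yrast floor at `(U, δ)` ⇒ the pointwise infrared ∀ b : ℝ, 0 < b → ∃ η : ℝ, 0 < η ∧ ∀ᶠ k : ℕ in Filter.atTop,
    ∀ ψ : Fock (Orb (FermionTorus 2 (2 * k + 1 + 1))),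
      IsGroundStateInSector (hubbardTorus 2 (2 * k + 1 + 1) 1 U) (2 * ⌊(1 - δ) * (((2 * k + 1 + 1) : ℕ) : ℝ) ^ 2 / 2⌋₊) 0 ψ → star ψ ⬝ᵥ ψ = 1 →
        (∑ m ∈ (Finset.univ.filter fun m : Literature.Probability.LatticeModels.TorusSite 2 (2 * k + 1 + 1) =>
            m ≠ 0 ∧ momentumNormSq (2 * k + 1 + 1) m < η ^ 2),
          pairStructureFactor dWaveFormFactor (2 * k + 1 + 1) ψ m) / ((2 * k + 1 + 1 : ℕ) : ℝ) ^ 2 ≤ b at `(U, δ)`** (`U > 0`): the two previous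
theorems composed — the infrared half of the crux DERIVED from the Landau floor; also a pointwise SUPPLIER for item
stmt-1089. [folklore] -/
theorem infraredLeak_of_pairYrastFloorAt {U δ : ℝ} (hU : 0 < U)
    (hYat : ∃ c α η M₀ : ℝ, 0 < c ∧ α < 2 ∧ 0 < η ∧ ∀ᶠ k : ℕ in Filter.atTop, ∀ ψ : Fock (Orb (FermionTorus 2 (2 * k + 1 + 1))), IsGroundStateInSector (hubbardTorus 2 (2 * k + 1 + 1) 1 U) (2 * ⌊(1 - δ) * ((2 * k + 1 + 1 : ℕ) : ℝ) ^ 2 / 2⌋₊) 0 ψ → star ψ ⬝ᵥ ψ = 1 → ∀ m : TorusSite 2 (2 * k + 1 + 1), m ≠ 0 → momentumNormSq (2 * k + 1 + 1) m ≤ η ^ 2 → ∃ μ' : ℝ, |μ'| ≤ M₀ ∧ ∀ E : ℝ, hubbardTorusWith 2 (2 * k + 1 + 1) 1 U μ' *ᵥ ψ = (E : ℂ) • ψ → (E + c * momentumNormSq (2 * k + 1 + 1) m ^ (α / 2)) * (star (pairFieldAt dWaveFormFactor (2 * k + 1 + 1) m *ᵥ ψ) ⬝ᵥ (pairFieldAt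 dWaveFormFactor (2 * k + 1 + 1) m *ᵥ ψ)).re ≤ (star (pairFieldAt dWaveFormFactor (2 * k + 1 + 1) m *ᵥ ψ) ⬝ᵥ (hubbardTorusWith 2 (2 * k + 1 + 1) 1 U μ' *ᵥ (pairFieldAt dWaveFormFactor (2 * k + 1 + 1) m *ᵥ ψ))).re ∧ (E + c * momentumNormSq (2 * k + 1 + 1) m ^ (α / 2)) * (star ((pairFieldAt dWaveFormFactor (2 * k + 1 + 1) m)ᴴ *ᵥ ψ) ⬝ᵥ ((pairFieldAt dWaveFormFactor (2 * k + 1 + 1) m)ᴴ *ᵥ ψ)).re ≤ (star ((pairFieldAt dWaveFormFactor (2 * k + 1 + 1) m)ᴴ *ᵥ ψ) ⬝ᵥ (hubbardTorusWith 2 (2 * k + 1 + 1) 1 U μ' *ᵥ ((pairFieldAt dWaveFormFactor (2 * k + 1 + 1) m)ᴴ *ᵥ ψ))).re) :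
    ∀ b : ℝ, 0 < b → ∃ η : ℝ, 0 < η ∧ ∀ᶠ k : ℕ in Filter.atTop,
    ∀ ψ : Fock (Orb (FermionTorus 2 (2 * k + 1 + 1))),
      IsGroundStateInSector (hubbardTorus 2 (2 * k + 1 + 1) 1 U) (2 * ⌊(1 - δ) * (((2 * k + 1 + 1) : ℕ) : ℝ) ^ 2 / 2⌋₊) 0 ψ → star ψ ⬝ᵥ ψ = 1 →
        (∑ m ∈ (Finset.univ.filter fun m : Literature.Probability.LatticeModels.TorusSite 2 (2 * k + 1 + 1) =>
            m ≠ 0 ∧ momentumNormSq (2 * k + 1 + 1) m < η ^ 2),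
          pairStructureFactor dWaveFormFactor (2 * k + 1 + 1) ψ m) / ((2 * k + 1 + 1 : ℕ) : ℝ) ^ 2 ≤ b :=
  infraredLeak_of_infraredCeilingAt (infraredCeilingAt_of_pairYrastFloorAt hU hYat)

/-! ## §4 The summit matrix at `(U, δ)`, pointwise -/

/-- **FP(U,δ) ∧ Y(U,δ) ⇒ the summit matrix at `(U, δ)`** for `U > 0`: derivative face purity plus the pair-yrast
floor give `HasDWavePairFieldLROAt U δ` (landed Fejér dissection `floor_of_deriv_of_leak` + kernel
`hasDWavePairFieldLROAt_of_floor`). [folklore] -/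
theorem hasDWavePairFieldLROAt_of_facePurityAt_of_pairYrastFloorAt {U δ : ℝ} (hU : 0 < U)
    (hP : ∃ a : ℝ, 0 < a ∧ ∀ R : ℕ, 0 < R → ∀ᶠ k : ℕ in Filter.atTop, ∀ ψ : Fock (Orb (FermionTorus 2 (2 * k + 1 + 1))), IsGroundStateInSector (hubbardTorus 2 (2 * k + 1 + 1) 1 U) (2 * ⌊(1 - δ) * ((2 * k + 1 + 1 : ℕ) : ℝ) ^ 2 / 2⌋₊) 0 ψ → star ψ ⬝ᵥ ψ = 1 → a * ((2 * k + 1 + 1 : ℕ) : ℝ) ^ 2 ≤ (star ψ ⬝ᵥ ((((((R : ℝ) ^ 4)⁻¹ : ℝ) : ℂ) • ∑ x : TorusSite 2 (2 * k + 1 + 1), (∑ u : Fin 2 → Fin R, localPair dWaveFormFactor (2 * k + 1 + 1) (x + fun i => ((u i : ℕ) : ZMod (2 * k + 1 + 1))))ᴴ * (∑ u : Fin 2 → Fin R, localPair dWaveFormFactor (2 * k + 1 + 1) (x + fun i => ((u i : ℕ) : ZMod (2 * k + 1 + 1))))) *ᵥ ψ)).re)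
    (hYat : ∃ c α η M₀ : ℝ, 0 < c ∧ α < 2 ∧ 0 < η ∧ ∀ᶠ k : ℕ in Filter.atTop, ∀ ψ : Fock (Orb (FermionTorus 2 (2 * k + 1 + 1))), IsGroundStateInSector (hubbardTorus 2 (2 * k + 1 + 1) 1 U) (2 * ⌊(1 - δ) * ((2 * k + 1 + 1 : ℕ) : ℝ) ^ 2 / 2⌋₊) 0 ψ → star ψ ⬝ᵥ ψ = 1 → ∀ m : TorusSite 2 (2 * k + 1 + 1), m ≠ 0 → momentumNormSq (2 * k + 1 + 1) m ≤ η ^ 2 → ∃ μ' : ℝ, |μ'| ≤ M₀ ∧ ∀ E : ℝ, hubbardTorusWith 2 (2 * k + 1 + 1) 1 U μ' *ᵥ ψ = (E : ℂ) • ψ → (E + c * momentumNormSq (2 * k + 1 + 1) m ^ (α / 2)) * (star (pairFieldAt dWaveFormFactor (2 * k + 1 + 1) m *ᵥ ψ) ⬝ᵥ (pairFieldAt dWaveFormFactor (2 * k + 1 + 1) m *ᵥ ψ)).re ≤ (star (pairFieldAt dWaveFormFactor (2 * k + 1 + 1) m *ᵥ ψ) ⬝ᵥ (hubbardTorusWith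 2 (2 * k + 1 + 1) 1 U μ' *ᵥ (pairFieldAt dWaveFormFactor (2 * k + 1 + 1) m *ᵥ ψ))).re ∧ (E + c * momentumNormSq (2 * k + 1 + 1) m ^ (α / 2)) * (star ((pairFieldAt dWaveFormFactor (2 * k + 1 + 1) m)ᴴ *ᵥ ψ) ⬝ᵥ ((pairFieldAt dWaveFormFactor (2 * k + 1 + 1) m)ᴴ *ᵥ ψ)).re ≤ (star ((pairFieldAt dWaveFormFactor (2 * k + 1 + 1) m)ᴴ *ᵥ ψ) ⬝ᵥ (hubbardTorusWith 2 (2 * k + 1 + 1) 1 U μ' *ᵥ ((pairFieldAt dWaveFormFactor (2 * k + 1 + 1) m)ᴴ *ᵥ ψ))).re) :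
    HasDWavePairFieldLROAt U δ :=
  hasDWavePairFieldLROAt_of_floor (floor_of_deriv_of_leak hP (infraredLeak_of_pairYrastFloorAt hU hYat))

/-- **FP(U,δ) ∧ infrared ceiling(U,δ) ⇒ the summit matrix at `(U, δ)`**: the minimal form of the line's inputs.
[folklore] -/
theorem hasDWavePairFieldLROAt_of_facePurityAt_of_infraredCeilingAt {U δ : ℝ}
    (hP : ∃ a : ℝ, 0 < a ∧ ∀ R : ℕ, 0 < R → ∀ᶠ k : ℕ in Filter.atTop, ∀ ψ : Fock (Orb (FermionTorus 2 (2 * k + 1 + 1))), IsGroundStateInSector (hubbardTorus 2 (2 * k + 1 + 1) 1 U) (2 * ⌊(1 - δ) * ((2 * k + 1 + 1 : ℕ) : ℝ) ^ 2 / 2⌋₊) 0 ψ → star ψ ⬝ᵥ ψ = 1 → a * ((2 * k + 1 + 1 : ℕ) : ℝ) ^ 2 ≤ (star ψ ⬝ᵥ ((((((R : ℝ) ^ 4)⁻¹ : ℝ) : ℂ) • ∑ x : TorusSite 2 (2 * k + 1 + 1), (∑ u : Fin 2 → Fin R, localPair dWaveFormFactor (2 * k + 1 + 1) (x + fun i =>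 ((u i : ℕ) : ZMod (2 * k + 1 + 1))))ᴴ * (∑ u : Fin 2 → Fin R, localPair dWaveFormFactor (2 * k + 1 + 1) (x + fun i => ((u i : ℕ) : ZMod (2 * k + 1 + 1))))) *ᵥ ψ)).re)
    (hC : ∃ A α η : ℝ, α < 2 ∧ 0 < η ∧ ∀ᶠ k : ℕ in Filter.atTop, ∀ ψ : Fock (Orb (FermionTorus 2 (2 * k + 1 + 1))), IsGroundStateInSector (hubbardTorus 2 (2 * k + 1 + 1) 1 U) (2 * ⌊(1 - δ) * ((2 * k + 1 + 1 : ℕ) : ℝ) ^ 2 / 2⌋₊) 0 ψ → star ψ ⬝ᵥ ψ = 1 → ∀ m : TorusSite 2 (2 * k + 1 + 1), m ≠ 0 → momentumNormSq (2 * k + 1 + 1) m ≤ η ^ 2 → pairStructureFactor dWaveFormFactor (2 * k + 1 + 1) ψ m ≤ A * (momentumNormSq (2 * k + 1 + 1) m ^ (α / 2))⁻¹) :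
    HasDWavePairFieldLROAt U δ :=
  hasDWavePairFieldLROAt_of_floor (floor_of_deriv_of_leak hP (infraredLeak_of_infraredCeilingAt hC))

/-! ## §5 The crux BY NAME from the line's two open stubs (glue a planner can file) -/

/-- **Crux glue, door 1: (FP) ∧ (Y) ⇒ `SsbToEvenTorusLro`.** The hypotheses are VERBATIM the registered open stubs
`stub_facePurity` and `stub_pairYrastFloor` of line `pair-yrast-landau-floor`; everything else is landed. [folklore] -/
theorem SsbToEvenTorusLro_of_facePurity_of_pairYrastFloor :
    (∀ (U δ μ : ℝ), 0 < U → δ ∈ Set.Ioo (0:ℝ) 1 → Filter.Tendsto (fun L : ℕ => ((hubbardTorusWith 2 (L + 1) 1 U μ).groundStateFunctional totalNumber).re / ((L + 1 : ℕ) : ℝ) ^ 2) Filter.atTop (nhds (1 - δ)) → HasDWaveOrder U μ → ∃ a : ℝ, 0 < a ∧ ∀ R : ℕ, 0 < R → ∀ᶠ k : ℕ in Filter.atTop, ∀ ψ : Fock (Orb (FermionTorus 2 (2 * k + 1 + 1))), IsGroundStateInSector (hubbardTorus 2 (2 * k + 1 + 1) 1 U) (2 * ⌊(1 - δ) * ((2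 * k + 1 + 1 : ℕ) : ℝ) ^ 2 / 2⌋₊) 0 ψ → star ψ ⬝ᵥ ψ = 1 → a * ((2 * k + 1 + 1 : ℕ) : ℝ) ^ 2 ≤ (star ψ ⬝ᵥ ((((((R : ℝ) ^ 4)⁻¹ : ℝ) : ℂ) • ∑ x : TorusSite 2 (2 * k + 1 + 1), (∑ u : Fin 2 → Fin R, localPair dWaveFormFactor (2 * k + 1 + 1) (x + fun i => ((u i : ℕ) : ZMod (2 * k + 1 + 1))))ᴴ * (∑ u : Fin 2 → Fin R, localPair dWaveFormFactor (2 * k + 1 + 1) (x + fun i => ((u i : ℕ) : ZMod (2 * k + 1 + 1))))) *ᵥ ψ)).re) →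
    (∀ (U δ μ : ℝ), 0 < U → δ ∈ Set.Ioo (0:ℝ) 1 → Filter.Tendsto (fun L : ℕ => ((hubbardTorusWith 2 (L + 1) 1 U μ).groundStateFunctional totalNumber).re / ((L + 1 : ℕ) : ℝ) ^ 2) Filter.atTop (nhds (1 - δ)) → HasDWaveOrder U μ → ∃ c α η M₀ : ℝ, 0 < c ∧ α < 2 ∧ 0 < η ∧ ∀ᶠ k : ℕ in Filter.atTop, ∀ ψ : Fock (Orb (FermionTorus 2 (2 * k + 1 + 1))), IsGroundStateInSector (hubbardTorus 2 (2 * k + 1 + 1) 1 U) (2 * ⌊(1 - δ) * ((2 * k + 1 + 1 : ℕ) : ℝ) ^ 2 / 2⌋₊) 0 ψ → star ψ ⬝ᵥ ψ = 1 → ∀ m : TorusSite 2 (2 * k + 1 + 1), m ≠ 0 → momentumNormSq (2 * k + 1 + 1) m ≤ η ^ 2 → ∃ μ' : ℝ, |μ'| ≤ M₀ ∧ ∀ E : ℝ, hubbardTorusWith 2 (2 * k + 1 + 1) 1 U μ' *ᵥ ψ = (E : ℂ) • ψ → (E + c * momentumNormSq (2 * k + 1 + 1) m ^ (α / 2)) *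 (star (pairFieldAt dWaveFormFactor (2 * k + 1 + 1) m *ᵥ ψ) ⬝ᵥ (pairFieldAt dWaveFormFactor (2 * k + 1 + 1) m *ᵥ ψ)).re ≤ (star (pairFieldAt dWaveFormFactor (2 * k + 1 + 1) m *ᵥ ψ) ⬝ᵥ (hubbardTorusWith 2 (2 * k + 1 + 1) 1 U μ' *ᵥ (pairFieldAt dWaveFormFactor (2 * k + 1 + 1) m *ᵥ ψ))).re ∧ (E + c * momentumNormSq (2 * k + 1 + 1) m ^ (α / 2)) * (star ((pairFieldAt dWaveFormFactor (2 * k + 1 + 1) m)ᴴ *ᵥ ψ) ⬝ᵥ ((pairFieldAt dWaveFormFactor (2 * k + 1 + 1) m)ᴴ *ᵥ ψ)).re ≤ (star ((pairFieldAt dWaveFormFactor (2 * k + 1 + 1) m)ᴴ *ᵥ ψ) ⬝ᵥ (hubbardTorusWith 2 (2 * k + 1 + 1) 1 U μ' *ᵥ ((pairFieldAt dWaveFormFactor (2 * k + 1 + 1) m)ᴴ *ᵥ ψ))).re) →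
    SsbToEvenTorusLro :=
  fun hFP hY U δ μ hU hδ hdm hO =>
    hasDWavePairFieldLROAt_of_facePurityAt_of_pairYrastFloorAt hU (hFP U δ μ hU hδ hdm hO) (hY U δ μ hU hδ hdm hO)

/-- **Crux glue, door 3: (FP) ∧ (infrared ceiling) ⇒ `SsbToEvenTorusLro`** — the MINIMAL residue of the line: derivative
face purity plus the Goldstone-shape ceiling `S_ψ(m) ≤ A|q_m|^{-α}` (`α < 2`) on the punctured window of every sector
ground state (implied by (Y) ∧ (B), `infraredCeilingAt_of_pairYrastFloorAt`). [folklore] -/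
theorem SsbToEvenTorusLro_of_facePurity_of_infraredCeiling
    (hFP : ∀ (U δ μ : ℝ), 0 < U → δ ∈ Set.Ioo (0:ℝ) 1 → Filter.Tendsto (fun L : ℕ => ((hubbardTorusWith 2 (L + 1) 1 U μ).groundStateFunctional totalNumber).re / ((L + 1 : ℕ) : ℝ) ^ 2) Filter.atTop (nhds (1 - δ)) → HasDWaveOrder U μ → ∃ a : ℝ, 0 < a ∧ ∀ R : ℕ, 0 < R → ∀ᶠ k : ℕ in Filter.atTop, ∀ ψ : Fock (Orb (FermionTorus 2 (2 * k + 1 + 1))), IsGroundStateInSector (hubbardTorus 2 (2 * k + 1 + 1) 1 U) (2 * ⌊(1 - δ) * ((2 * k + 1 + 1 : ℕ) : ℝ) ^ 2 / 2⌋₊) 0 ψ → star ψ ⬝ᵥ ψ = 1 → a * ((2 * k + 1 + 1 : ℕ) : ℝ) ^ 2 ≤ (star ψ ⬝ᵥ ((((((R : ℝ) ^ 4)⁻¹ : ℝ) : ℂ) • ∑ x : TorusSite 2 (2 * k + 1 + 1), (∑ u : Fin 2 → Fin R, localPair dWaveFormFactor (2 * k + 1 + 1) (x + fun i => ((u i :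 ℕ) : ZMod (2 * k + 1 + 1))))ᴴ * (∑ u : Fin 2 → Fin R, localPair dWaveFormFactor (2 * k + 1 + 1) (x + fun i => ((u i : ℕ) : ZMod (2 * k + 1 + 1))))) *ᵥ ψ)).re)
    (hC : ∀ (U δ μ : ℝ), 0 < U → δ ∈ Set.Ioo (0:ℝ) 1 → Filter.Tendsto (fun L : ℕ => ((hubbardTorusWith 2 (L + 1) 1 U μ).groundStateFunctional totalNumber).re / ((L + 1 : ℕ) : ℝ) ^ 2) Filter.atTop (nhds (1 - δ)) → HasDWaveOrder U μ → ∃ A α η : ℝ, α < 2 ∧ 0 < η ∧ ∀ᶠ k : ℕ in Filter.atTop, ∀ ψ : Fock (Orb (FermionTorus 2 (2 * k + 1 + 1))), IsGroundStateInSector (hubbardTorus 2 (2 * k + 1 + 1) 1 U) (2 * ⌊(1 - δ) * ((2 * k + 1 + 1 : ℕ) : ℝ) ^ 2 / 2⌋₊) 0 ψ → star ψ ⬝ᵥ ψ = 1 → ∀ m : TorusSite 2 (2 * k + 1 + 1), m ≠ 0 → momentumNormSq (2 * k + 1 + 1) m ≤ η ^ 2 → pairStructureFactor dWaveFormFactor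 (2 * k + 1 + 1) ψ m ≤ A * (momentumNormSq (2 * k + 1 + 1) m ^ (α / 2))⁻¹) :
    SsbToEvenTorusLro :=
  fun U δ μ hU hδ hdm hO =>
    hasDWavePairFieldLROAt_of_facePurityAt_of_infraredCeilingAt (hFP U δ μ hU hδ hdm hO) (hC U δ μ hU hδ hdm hO)

/-- **Dissection: MODULO the pair-yrast floor, the crux IS derivative face purity.** Given (Y), `SsbToEvenTorusLro`
is EQUIVALENT to the registered stub `stub_facePurity` (sufficiency: door 1; necessity: the crux's consequent at
`(U, δ)` forces the every-ground-state block-coherence floor, the sibling's landed `deriv_of_hasDWavePairFieldLROAt`). So the line reduces nothing at (FP) and everything it adds is the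
infrared half (Y) ⇒ leak. [folklore] -/
theorem ssbToEvenTorusLro_iff_facePurity_of_pairYrastFloor
    (hY : ∀ (U δ μ : ℝ), 0 < U → δ ∈ Set.Ioo (0:ℝ) 1 → Filter.Tendsto (fun L : ℕ => ((hubbardTorusWith 2 (L + 1) 1 U μ).groundStateFunctional totalNumber).re / ((L + 1 : ℕ) : ℝ) ^ 2) Filter.atTop (nhds (1 - δ)) → HasDWaveOrder U μ → ∃ c α η M₀ : ℝ, 0 < c ∧ α < 2 ∧ 0 < η ∧ ∀ᶠ k : ℕ in Filter.atTop, ∀ ψ : Fock (Orb (FermionTorus 2 (2 * k + 1 + 1))), IsGroundStateInSector (hubbardTorus 2 (2 * k + 1 + 1) 1 U) (2 * ⌊(1 - δ) * ((2 * k + 1 + 1 : ℕ) : ℝ) ^ 2 / 2⌋₊) 0 ψ → star ψ ⬝ᵥ ψ = 1 → ∀ m : TorusSite 2 (2 * k + 1 + 1), m ≠ 0 → momentumNormSq (2 * k + 1 + 1) m ≤ η ^ 2 → ∃ μ' : ℝ, |μ'| ≤ M₀ ∧ ∀ E : ℝ, hubbardTorusWith 2 (2 * k + 1 + 1) 1 U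 μ' *ᵥ ψ = (E : ℂ) • ψ → (E + c * momentumNormSq (2 * k + 1 + 1) m ^ (α / 2)) * (star (pairFieldAt dWaveFormFactor (2 * k + 1 + 1) m *ᵥ ψ) ⬝ᵥ (pairFieldAt dWaveFormFactor (2 * k + 1 + 1) m *ᵥ ψ)).re ≤ (star (pairFieldAt dWaveFormFactor (2 * k + 1 + 1) m *ᵥ ψ) ⬝ᵥ (hubbardTorusWith 2 (2 * k + 1 + 1) 1 U μ' *ᵥ (pairFieldAt dWaveFormFactor (2 * k + 1 + 1) m *ᵥ ψ))).re ∧ (E + c * momentumNormSq (2 * k + 1 + 1) m ^ (α / 2)) * (star ((pairFieldAt dWaveFormFactor (2 * k + 1 + 1) m)ᴴ *ᵥ ψ) ⬝ᵥ ((pairFieldAt dWaveFormFactor (2 * k + 1 + 1) m)ᴴ *ᵥ ψ)).re ≤ (star ((pairFieldAt dWaveFormFactor (2 * k + 1 + 1) m)ᴴ *ᵥ ψ) ⬝ᵥ (hubbardTorusWith 2 (2 * k + 1 + 1) 1 U μ' *ᵥ ((pairFieldAt dWaveFormFactor (2 * k + 1 + 1) m)ᴴ *ᵥ ψ))).re)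 :
    SsbToEvenTorusLro ↔ (∀ (U δ μ : ℝ), 0 < U → δ ∈ Set.Ioo (0:ℝ) 1 → Filter.Tendsto (fun L : ℕ => ((hubbardTorusWith 2 (L + 1) 1 U μ).groundStateFunctional totalNumber).re / ((L + 1 : ℕ) : ℝ) ^ 2) Filter.atTop (nhds (1 - δ)) → HasDWaveOrder U μ → ∃ a : ℝ, 0 < a ∧ ∀ R : ℕ, 0 < R → ∀ᶠ k : ℕ in Filter.atTop, ∀ ψ : Fock (Orb (FermionTorus 2 (2 * k + 1 + 1))), IsGroundStateInSector (hubbardTorus 2 (2 * k + 1 + 1) 1 U) (2 * ⌊(1 - δ) * ((2 * k + 1 + 1 : ℕ) : ℝ) ^ 2 / 2⌋₊) 0 ψ → star ψ ⬝ᵥ ψ = 1 → a * ((2 * k + 1 + 1 : ℕ) : ℝ) ^ 2 ≤ (star ψ ⬝ᵥ ((((((R : ℝ) ^ 4)⁻¹ : ℝ) : ℂ) • ∑ x : TorusSite 2 (2 * k + 1 + 1), (∑ u : Fin 2 → Fin R, localPair dWaveFormFactor (2 * k + 1 + 1) (x + fun i => ((u i : ℕ) : ZMod (2 * k + 1 +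 1))))ᴴ * (∑ u : Fin 2 → Fin R, localPair dWaveFormFactor (2 * k + 1 + 1) (x + fun i => ((u i : ℕ) : ZMod (2 * k + 1 + 1))))) *ᵥ ψ)).re) :=
  ⟨fun h U δ μ hU hδ hdm hO => Summit.HubbardSuperconductivity.WcbcsSsbToTorusLRO.Negative.deriv_of_hasDWavePairFieldLROAt hδ.1.le (h U δ μ hU hδ hdm hO),
    fun hFP => SsbToEvenTorusLro_of_facePurity_of_pairYrastFloor hFP hY⟩

/-! ## §6 What the ROUTE consumes: with item stmt-1089 by name, face purity alone serves the target's box -/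

/-- **(FP) ∧ item stmt-1089 ⇒ the transfer on the half range `δ < 1/2`** (where `KacWindowPenalty.WindowInfraredBound`
speaks): at every `U > 0`, `δ ∈ (0, 1/2)`, density matching and Koma–Tasaki order give the summit matrix, from derivative
face purity and 1089's leak (landed `leak_of_windowInfraredBound`). The crux's extra territory `δ ∈ [1/2, 1)` is the
only place where (Y)/(ceiling) is needed instead of 1089 — and the route never goes there. [folklore] -/
theorem halfRangeMatrix_of_facePurity_of_windowInfraredBound
    (hFP : ∀ (U δ μ : ℝ), 0 < U → δ ∈ Set.Ioo (0:ℝ) 1 → Filter.Tendsto (fun L : ℕ => ((hubbardTorusWith 2 (L + 1) 1 U μ).groundStateFunctional totalNumber).re / ((L + 1 : ℕ) : ℝ) ^ 2) Filter.atTop (nhds (1 - δ)) → HasDWaveOrder U μ → ∃ a : ℝ, 0 < a ∧ ∀ R : ℕ, 0 < R → ∀ᶠ k : ℕ in Filter.atTop, ∀ ψ : Fock (Orb (FermionTorus 2 (2 * k + 1 + 1))), IsGroundStateInSector (hubbardTorus 2 (2 * k + 1 + 1) 1 U) (2 * ⌊(1 - δ) * ((2 * k + 1 + 1 : ℕ)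 : ℝ) ^ 2 / 2⌋₊) 0 ψ → star ψ ⬝ᵥ ψ = 1 → a * ((2 * k + 1 + 1 : ℕ) : ℝ) ^ 2 ≤ (star ψ ⬝ᵥ ((((((R : ℝ) ^ 4)⁻¹ : ℝ) : ℂ) • ∑ x : TorusSite 2 (2 * k + 1 + 1), (∑ u : Fin 2 → Fin R, localPair dWaveFormFactor (2 * k + 1 + 1) (x + fun i => ((u i : ℕ) : ZMod (2 * k + 1 + 1))))ᴴ * (∑ u : Fin 2 → Fin R, localPair dWaveFormFactor (2 * k + 1 + 1) (x + fun i => ((u i : ℕ) : ZMod (2 * k + 1 + 1))))) *ᵥ ψ)).re)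
    (hW : WindowInfraredBound) :
    ∀ (U δ μ : ℝ), 0 < U → δ ∈ Set.Ioo (0:ℝ) (1 / 2) → Filter.Tendsto (fun L : ℕ => ((hubbardTorusWith 2 (L + 1) 1 U μ).groundStateFunctional totalNumber).re / ((L + 1 : ℕ) : ℝ) ^ 2) Filter.atTop (nhds (1 - δ)) → HasDWaveOrder U μ → HasDWavePairFieldLROAt U δ :=
  fun U δ μ hU hδ hdm hO =>
    hasDWavePairFieldLROAt_of_floor (floor_of_deriv_of_leak
      (hFP U δ μ hU ⟨hδ.1, by linarith [hδ.2]⟩ hdm hO) (leak_of_windowInfraredBound hW hU hδ))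

/-- **The summit from (FP), item stmt-1089 and the route's target `FixedPointDWaveOrder`** (the route's `closes`
re-run through the box, cf. Disproof §5 `closes_box`): for route `AposterioriCapRg` the every-ground-state transfer
is needed only at the certified point `(U, δ) ∈ [2,3] × [1/5, 7/20]`, where (FP) + 1089 already deliver it. So the
crux `SsbToEvenTorusLro` can be replaced, for THIS route, by {derivative face purity (or repelled order persistence),
item stmt-1089} — the same two open ends as the sibling cruxes stmt-2009 / stmt-10439. [folklore] -/
theorem hubbardSuperconductivity_of_facePurity_of_windowInfraredBound_of_fixedPoint
    (hFP : ∀ (U δ μ : ℝ), 0 < U → δ ∈ Set.Ioo (0:ℝ) 1 → Filter.Tendsto (fun L : ℕ => ((hubbardTorusWith 2 (L + 1) 1 U μ).groundStateFunctional totalNumber).re / ((L + 1 : ℕ) : ℝ) ^ 2) Filter.atTop (nhds (1 - δ)) → HasDWaveOrder U μ → ∃ a : ℝ, 0 < a ∧ ∀ R : ℕ, 0 < R → ∀ᶠ k : ℕ in Filter.atTop, ∀ ψ : Fock (Orb (FermionTorus 2 (2 * k + 1 + 1))), IsGroundStateInSector (hubbardTorus 2 (2 * k + 1 + 1) 1 U)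 (2 * ⌊(1 - δ) * ((2 * k + 1 + 1 : ℕ) : ℝ) ^ 2 / 2⌋₊) 0 ψ → star ψ ⬝ᵥ ψ = 1 → a * ((2 * k + 1 + 1 : ℕ) : ℝ) ^ 2 ≤ (star ψ ⬝ᵥ ((((((R : ℝ) ^ 4)⁻¹ : ℝ) : ℂ) • ∑ x : TorusSite 2 (2 * k + 1 + 1), (∑ u : Fin 2 → Fin R, localPair dWaveFormFactor (2 * k + 1 + 1) (x + fun i => ((u i : ℕ) : ZMod (2 * k + 1 + 1))))ᴴ * (∑ u : Fin 2 → Fin R, localPair dWaveFormFactor (2 * k + 1 + 1) (x + fun i => ((u i : ℕ) : ZMod (2 * k + 1 + 1))))) *ᵥ ψ)).re)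
    (hW : WindowInfraredBound) (hT : FixedPointDWaveOrder) : _root_.HubbardSuperconductivity := by
  obtain ⟨U, hU, δ, hδ, μ, hdens, hord⟩ := hT
  have hU0 : (0 : ℝ) < U := by linarith [hU.1]
  have hδ' : δ ∈ Set.Ioo (0:ℝ) (1 / 2) := ⟨by linarith [hδ.1], by linarith [hδ.2]⟩
  unfold HubbardSuperconductivity Literature.Hubbard.DWaveSuperconductivityHubbard
  exact ⟨U, hU0, δ, hδ', halfRangeMatrix_of_facePurity_of_windowInfraredBound hFP hW U δ μ hU0 hδ' hdens hord⟩

end Summit.HubbardSuperconductivity.HubbardSuperconductivity.Theorems
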